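import Mathlib.NumberTheory.Padics.Complex
import Mathlib.LinearAlgebra.Matrix.Charpoly.Coeff
import Mathlib.Analysis.Normed.Group.Ultra
import HarnessLib

/-!
# The Leibniz bound for `det(1 - AT)` (Koblitz, Ch. V §3, pp. 130–131)

Part of the bottom-up proof of Dwork's rationality theorem
(`Literature/NumberTheory/LFunctions/DworkRationality.lean`), towards the named fact
`Dwork.dworkFredholmMatrix` (`…/DworkRationalityFredholm.lean`; Koblitz, GTM 58, Ch. V §3,
Lemma 4). Koblitz (p. 130) bounds the coefficients `b_m` of `det(1 - AT)`,
`b_m = (-1)ᵐ ∑_{u₁<⋯<u_m, σ} sgn(σ) a_{u₁,σ(u₁)} ⋯ a_{u_m,σ(u_m)}`, for the matrix `A = (g_{qv-u})`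
of `Ψ = T_q ∘ G`, `G ∈ R₀`, through
`ord_p [g_{qσ(u₁)-u₁} ⋯ g_{qσ(u_m)-u_m}] ≥ M ∑ (q|σ(uᵢ)| - |uᵢ|) = M(q-1) ∑ |uᵢ|`.
This file proves that bound for an arbitrary finite square matrix over `ℂ_p` satisfying
`‖B_{i,j}‖ ≤ ρ^{q·deg i - deg j}` (`0 ≤ ρ ≤ 1`, `q ≥ 1`, a weight `deg` on the index type):

* `coeff_prod_C_add_X_mul_C` — `[Xᵐ] ∏_{i∈T} (cᵢ + dᵢ X) = ∑_{S ⊆ T, #S = m} ∏_{i∈S} dᵢ ∏_{i∈T∖S} cᵢ`;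
* `Literature.NumberTheory.LFunctions.Dwork.norm_coeff_charpolyRev_le` — **the Leibniz bound**:
  if every `m`-element set `S` of indices has `μ ≤ ∑_{i∈S} deg i`, then
  `‖[Tᵐ] det(1 - TB)‖ ≤ ρ^{(q-1)μ}`. In the Leibniz expansion, the term of a permutation `σ`
  contributes to `Tᵐ` only through `m`-sets `S` containing the support of `σ` (the diagonal
  entries of `1` off `S` must be `1`), such an `S` is `σ`-stable, and then
  `∑_{i∈S} (q·deg σ(i) - deg i) ≥ (q-1) ∑_{i∈S} deg i` because `σ` permutes `S`; the ultrametric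
  inequality does the rest.

## References

* N. Koblitz, *p-adic Numbers, p-adic Analysis, and Zeta-Functions*, 2nd ed., GTM 58 (1984),
  Ch. V §3, pp. 130–131. [Koblitz1984]
-/

open Polynomial Finset

noncomputable section

namespace Literature.NumberTheory.LFunctions

namespace Dwork

/-! ### Coefficients of products of linear polynomials -/

section Coeff

variable {K : Type*} [CommRing K] {α : Type*} [DecidableEq α]

/-- `[Xᵐ] ∏_{i∈T} (cᵢ + dᵢ X) = ∑_{S ⊆ T, #S = m} (∏_{i∈S} dᵢ)(∏_{i∈T∖S} cᵢ)`. [folklore] -/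
theorem coeff_prod_C_add_X_mul_C (T : Finset α) (c d : α → K) (m : ℕ) :
    (∏ i ∈ T, (C (c i) + X * C (d i))).coeff m =
      ∑ S ∈ T.powerset.filter (fun S => S.card = m), (∏ i ∈ S, d i) * ∏ i ∈ T \ S, c i := by
  have h : ∏ i ∈ T, (C (c i) + X * C (d i)) =
      ∑ S ∈ T.powerset, X ^ S.card * C ((∏ i ∈ S, d i) * ∏ i ∈ T \ S, c i) := by
    rw [show (fun i => C (c i) + X * C (d i)) = fun i => X * C (d i) + C (c i) from
      funext fun i => add_comm _ _, Finset.prod_add]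
    refine Finset.sum_congr rfl fun S _ => ?_
    rw [Finset.prod_mul_distrib, Finset.prod_const, map_mul, map_prod, map_prod]
    ring
  rw [h, Polynomial.finsetSum_coeff, Finset.sum_filter]
  refine Finset.sum_congr rfl fun S _ => ?_
  rw [Polynomial.coeff_X_pow_mul', Polynomial.coeff_C]
  by_cases hS : S.card = m
  · rw [if_pos hS.le, if_pos (by omega), if_pos hS]
  · by_cases hle : S.card ≤ m
    · rw [if_pos hle, if_neg (by omega), if_neg hS]
    · rw [if_neg hle, if_neg hS]

end Coeff

/-! ### The Leibniz bound -/

section Leibniz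

variable {p : ℕ} [Fact p.Prime] {n : Type*} [Fintype n] [DecidableEq n]

/-- The support of a permutation is contained in any set off which the permutation matrix has
non-zero diagonal: if `∏_{i ∉ S} δ_{σ(i),i} ≠ 0` then `σ` fixes the complement of `S`, hence
maps `S` to itself. [folklore] -/
theorem perm_mapsTo_of_prod_ne_zero {K : Type*} [CommRing K] [NoZeroDivisors K] [Nontrivial K]
    (σ : Equiv.Perm n) (S : Finset n)
    (h : ∏ i ∈ univ \ S, (1 : Matrix n n K) (σ i) i ≠ 0) {i : n} (hi : i ∈ S) : σ i ∈ S := by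
  have hfix : ∀ j, j ∉ S → σ j = j := by
    intro j hj
    by_contra hne
    apply h
    exact Finset.prod_eq_zero (mem_sdiff.mpr ⟨mem_univ j, hj⟩) (Matrix.one_apply_ne hne)
  by_contra hσi
  have h1 : σ i = i := σ.injective (hfix _ hσi)
  rw [h1] at hσi
  exact hσi hi

omit [Fintype n] in
/-- A permutation preserving a finite set preserves sums over it. [folklore] -/
theorem sum_comp_perm_eq_of_mapsTo (σ : Equiv.Perm n) (S : Finset n)
    (hS : ∀ i ∈ S, σ i ∈ S) (f : n → ℕ) : ∑ i ∈ S, f (σ i) = ∑ i ∈ S, f i := by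
  -- `σ` restricts to a bijection of `S` (injective self-map of a finite set)
  have hsurj : ∀ j ∈ S, ∃ i ∈ S, σ i = j := by
    intro j hj
    have himage : S.image σ = S := Finset.eq_of_subset_of_card_le
      (fun x hx => by obtain ⟨i, hi, rfl⟩ := mem_image.mp hx; exact hS i hi)
      (by rw [Finset.card_image_of_injective _ σ.injective])
    have : j ∈ S.image σ := by rw [himage]; exact hj
    obtain ⟨i, hi, h⟩ := mem_image.mp this
    exact ⟨i, hi, h⟩
  exact Finset.sum_nbij σ hS (fun a _ b _ h => σ.injective h) (fun j hj => by
    obtain ⟨i, hi, h⟩ := hsurj j (mem_coe.mp hj)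
    exact ⟨i, mem_coe.mpr hi, h⟩) (fun _ _ => rfl)

/-- **The Leibniz bound** (Koblitz, Ch. V §3, p. 130: `ord_p[g_{qσ(u₁)-u₁} ⋯ g_{qσ(u_m)-u_m}] ≥
M(q-1)∑|uᵢ|`, and "this shows that `ord_p b_m → ∞`"): let `B` be a square matrix over `ℂ_p`
indexed by a finite type with a weight `deg`, `0 ≤ ρ ≤ 1`, `q ∈ ℕ`, with
`‖B_{i,j}‖ ≤ ρ^{q·deg i - deg j}` (truncated subtraction). If `μ ≤ ∑_{i∈S} deg i` for every
`m`-element set `S` of indices, then `‖[Tᵐ] det(1 - TB)‖ ≤ ρ^{(q-1)μ}`. [cite: Koblitz1984, Ch. V §3] -/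
theorem norm_coeff_charpolyRev_le (B : Matrix n n ℂ_[p]) (deg : n → ℕ) {ρ : ℝ} (hρ0 : 0 ≤ ρ)
    (hρ1 : ρ ≤ 1) (q : ℕ) (hB : ∀ i j, ‖B i j‖ ≤ ρ ^ (q * deg i - deg j))
    {m μ : ℕ} (hμ : ∀ S : Finset n, S.card = m → μ ≤ ∑ i ∈ S, deg i) :
    ‖(B.charpolyRev).coeff m‖ ≤ ρ ^ ((q - 1) * μ) := by
  -- entries of `1 - X • B` in the form `c + d X`
  have hentry : ∀ σ : Equiv.Perm n, ∀ i : n,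
      (1 - (X : ℂ_[p][X]) • B.map C) (σ i) i =
        C ((1 : Matrix n n ℂ_[p]) (σ i) i) + X * C (-B (σ i) i) := by
    intro σ i
    rw [Matrix.sub_apply, Matrix.smul_apply, Matrix.map_apply, smul_eq_mul, map_neg,
      Matrix.one_apply, Matrix.one_apply]
    split_ifs <;> simp [sub_eq_add_neg]
  -- Leibniz expansion, ultrametric inequality over permutations
  rw [Matrix.charpolyRev, Matrix.det_apply', Polynomial.finsetSum_coeff]
  refine IsUltrametricDist.norm_sum_le_of_forall_le_of_nonneg (pow_nonneg hρ0 _) fun σ _ => ?_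
  have hsign : ‖((Equiv.Perm.sign σ : ℤ) : ℂ_[p])‖ = 1 := by
    rcases Int.units_eq_one_or (Equiv.Perm.sign σ) with h | h <;> simp [h]
  rw [← Polynomial.C_eq_intCast, Polynomial.coeff_C_mul, norm_mul, hsign, one_mul,
    Finset.prod_congr rfl (fun i _ => hentry σ i), coeff_prod_C_add_X_mul_C]
  -- ultrametric inequality over the `m`-subsets `S`
  refine IsUltrametricDist.norm_sum_le_of_forall_le_of_nonneg (pow_nonneg hρ0 _) fun S hS => ?_
  rw [mem_filter, mem_powerset] at hS
  by_cases hzero : ∏ i ∈ univ \ S, (1 : Matrix n n ℂ_[p]) (σ i) i = 0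
  · rw [hzero, mul_zero, norm_zero]
    exact pow_nonneg hρ0 _
  -- `σ` maps `S` to itself
  have hmaps : ∀ i ∈ S, σ i ∈ S := fun i hi => perm_mapsTo_of_prod_ne_zero σ S hzero hi
  have hdeg : ∑ i ∈ S, deg (σ i) = ∑ i ∈ S, deg i := sum_comp_perm_eq_of_mapsTo σ S hmaps deg
  -- the exponent inequality `∑ (q·deg σ i ∸ deg i) ≥ (q-1) ∑ deg i ≥ (q-1) μ`
  have hexp : (q - 1) * μ ≤ ∑ i ∈ S, (q * deg (σ i) - deg i) := by
    have h1 : q * ∑ i ∈ S, deg i ≤ ∑ i ∈ S, (q * deg (σ i) - deg i) + ∑ i ∈ S, deg i :=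
      calc q * ∑ i ∈ S, deg i = ∑ i ∈ S, q * deg (σ i) := by rw [← hdeg, Finset.mul_sum]
        _ ≤ ∑ i ∈ S, ((q * deg (σ i) - deg i) + deg i) :=
            Finset.sum_le_sum fun i _ => le_tsub_add
        _ = _ := Finset.sum_add_distrib
    refine (Nat.mul_le_mul_left _ (hμ S hS.2)).trans ?_
    rw [Nat.sub_mul, one_mul]
    omega
  -- the norm of the term of `(σ, S)`
  rw [norm_mul]
  calc ‖∏ i ∈ S, -B (σ i) i‖ * ‖∏ i ∈ univ \ S, (1 : Matrix n n ℂ_[p]) (σ i) i‖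
      ≤ ρ ^ ((q - 1) * μ) * 1 := mul_le_mul ?_ ?_ (norm_nonneg _) (pow_nonneg hρ0 _)
    _ = ρ ^ ((q - 1) * μ) := mul_one _
  · rw [norm_prod]
    calc ∏ i ∈ S, ‖-B (σ i) i‖ ≤ ∏ i ∈ S, ρ ^ (q * deg (σ i) - deg i) :=
          Finset.prod_le_prod (fun i _ => norm_nonneg _) fun i _ => by rw [norm_neg]; exact hB _ _
      _ = ρ ^ ∑ i ∈ S, (q * deg (σ i) - deg i) := Finset.prod_pow_eq_pow_sum _ _ _
      _ ≤ ρ ^ ((q - 1) * μ) := pow_le_pow_of_le_one hρ0 hρ1 hexp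
  · rw [norm_prod]
    exact Finset.prod_le_one (fun i _ => norm_nonneg _) fun i _ => by
      rw [Matrix.one_apply]; split_ifs <;> simp

end Leibniz

end Dwork

end Literature.NumberTheory.LFunctions
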